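import Literature.IUT.LogVolume.GenuineTowerLocalTypeThirty
import Literature.IUT.LogVolume.SubThetaFieldRamificationTateUnramified
import Literature.IUT.LogVolume.Corollary22FreyPoint
import Literature.IUT.LogVolume.Corollary22LegendreDeepAdmissiblePairs
import HarnessLib

/-!
# The LOCAL TYPE of the `l`-division tower of a genuine Θ-volume datum, TATE-EXACT form:
# `3 ∣ ord_{v₀} j(λ) ⇒ e(u | p) ∣ e(v₀ | p)·10·l`, `5 ∣ ord_{v₀} j(λ) ⇒ e(u | p) ∣ e(v₀ | p)·6·l` (proof-only)

Mochizuki, *Inter-universal Teichmüller theory IV* (RIMS manuscript Apr. 2020 = PRIMS **57** (2021)), Thm. 1.10,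
Steps (ii)–(iii) p. 24–26 (the tower `ℚ ⊆ F_tpd ⊆ F ⊆ K = F(E_F[l])`; locus of use only); J.-P. Serre, Invent. Math. **15**
(1972), §1.11–§1.12 (the Tate curve: `E[n]` is unramified at a multiplicative `v ∤ n` iff `n ∣ ord_v Δ_min`).

Twin of abc-iut-W-neg-1's `GenuineTowerLocalTypeThirty.lean` (`e(u | p) ∣ e(v₀ | p)·30·l`) with the `F/F_tpd` layer taken from
`SubThetaFieldRamificationTateUnramified.lean` (abc-iut-W-ref-2): over a BAD place `v₀ ∤ 30` of `λ` with `3 ∣ ord_{v₀} j(λ)`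
(resp. `5 ∣`, `15 ∣`) one has `e(w | v₀) ∣ 10` (resp. `6`, `2`), hence, with `e(u | w) ∣ l` for `K/F` (abc-iut-S-d1):

* `ThetaVolumeDatumAt.ramificationIdx_int_dvd_mul_of_tpd_F_dvd` — the tower bookkeeping abstracted: `e(w | v₀) ∣ m ⇒
  e(u | p) ∣ e(v₀ | p)·m·l` (`m = 60, 30` are the two landed files);
* `ThetaVolumeDatumAt.ramificationIdx_int_dvd_ten_mul_of_three_dvd_ord` / `…_six_mul_of_five_dvd_ord` /
  `…_two_mul_of_fifteen_dvd_ord` — `e(u | p) ∣ e(v₀ | p)·10·l` / `·6·l` / `·2·l`;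
* `…_ratPoint'` forms — at a rational point (`e(v₀ | p) = 1`), bad prime given by its residue characteristic `p ∉ {2, 3, 5, l}`:
  **`e(u | p) ∣ 10·l`** if `3 ∣ ord_p j(q)`, **`∣ 6·l`** if `5 ∣ ord_p j(q)`, `∣ 2·l` if `15 ∣ ord_p j(q)`;
* `Cor22.ord_jInv_ratPoint_triple_eq` — the Frey–Legendre dictionary made EXACT: for an abc triple and an odd prime
  `p ∣ abc`, **`ord_p j(a/c) = −2·v_p(abc)`** (equality form of abc-iut-S6's `Cor22.neg_ord_jInv_ratPoint_triple`), so the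
  divisibility hypotheses read `3 ∣ v_p(abc)`, `5 ∣ v_p(abc)`.

Consumer: the TE rows of HOME/plan/rescue/R-W/TARGETS.tsv with pole prime `p < 30·l + 2` (abc-iut-W-ref-2, rows 26–51).
Proof-only (no definition, no named fact); inputs BY NAME; classical; TAKES NO SIDE on [IUTchIII] Cor. 3.12.
[cite: Mochizuki2012, IUTchIV Thm. 1.10 proof Steps (ii)–(iii) p. 24–26] [claim: Mochizuki2012, status: disputed] for every IUT quotation.
-/

noncomputable section

open scoped Classical

namespace Literature.IUT.LogVolume

namespace Cor22

open NumberField IsDedekindDomain Literature.NumberTheory.DiophantineGeometry.GenEll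
open Literature.NumberTheory.EllipticCurves Literature.NumberTheory.NumberFields Literature.IUT.HodgeTheaters
open WeierstrassCurve IntermediateField Field
open Literature.NumberTheory.DiophantineGeometry

/-! ## The Frey–Legendre dictionary, exact form: `ord_p j(a/c) = −2·v_p(abc)` at an odd prime of `abc` -/

/-- **`ord_v j(a/c) = −2·v_p(abc)`** at the place `v` of `ℚ` over an ODD prime `p ∣ abc` of an abc triple `a + b = c`:
`j(a/c) = 2⁸(a² − ac + c²)³/(abc)²` (`Cor22.jInv_ratPoint_triple`) with `p ∤ 2⁸(a² − ac + c²)³` (if `p` divides one of the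
pairwise coprime `a, b, c` it does not divide `cb + a²`), `ord_v(abc) = v_p(abc)` (`ord_v(p) = 1`, `Cor22.ord_natGenerator_eq_one`).
Equality form of abc-iut-S6's `Cor22.neg_ord_jInv_ratPoint_triple` (`≥`). [cite: Mochizuki2012, IUTchIV Cor 2.2 proof p.44]
[cite: SilvermanAEC2009, Prop. III.1.7(b)] -/
theorem ord_jInv_ratPoint_triple_eq {a b c : ℕ} (h : IsABCTriple a b c) (v : HeightOneSpectrum (𝓞 ℚ))
    (hv2 : Rat.HeightOneSpectrum.natGenerator v ≠ 2) (hv : Rat.HeightOneSpectrum.natGenerator v ∣ a * b * c) :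
    ord ℚ v (jInv ((a : ℚ) / c)) = -(2 * (((a * b * c).factorization (Rat.HeightOneSpectrum.natGenerator v) : ℕ) : ℤ)) := by
  obtain ⟨ha, hb, habc, hcop⟩ := h
  set p := Rat.HeightOneSpectrum.natGenerator v with hpdef
  have hp : p.Prime := Rat.HeightOneSpectrum.prime_natGenerator v
  have hc : 0 < c := by omega
  have habc0 : a * b * c ≠ 0 := Nat.mul_ne_zero (Nat.mul_ne_zero ha.ne' hb.ne') hc.ne'
  -- pairwise coprimality
  have hcopac : Nat.Coprime a c := by rw [← habc, Nat.coprime_self_add_right]; exact hcop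
  have hcopbc : Nat.Coprime b c := by rw [← habc, add_comm, Nat.coprime_self_add_right]; exact hcop.symm
  -- `p ∤ 256·(cb + a²)³`
  have hN : ¬ p ∣ 256 * (c * b + a * a) ^ 3 := by
    intro hdvd
    have h256 : ¬ p ∣ 256 := by
      intro h'
      have : p ∣ 2 ^ 8 := by norm_num at h' ⊢; exact h'
      exact hv2 ((Nat.prime_dvd_prime_iff_eq hp Nat.prime_two).1 (hp.dvd_of_dvd_pow this))
    have hK : p ∣ c * b + a * a := by
      rcases (Nat.Prime.dvd_mul hp).1 hdvd with h' | h'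
      · exact absurd h' h256
      · exact hp.dvd_of_dvd_pow h'
    rcases (Nat.Prime.dvd_mul hp).1 hv with hab | hpc
    · rcases (Nat.Prime.dvd_mul hp).1 hab with hpa | hpb
      · -- `p ∣ a`: then `p ∣ cb`, so `p ∣ c` or `p ∣ b`
        have h1 : p ∣ c * b := by
          have : p ∣ a * a := dvd_mul_of_dvd_left hpa a
          exact (Nat.dvd_add_left this).mp hK
        rcases (Nat.Prime.dvd_mul hp).1 h1 with hpc | hpb
        · exact hp.one_lt.ne' (Nat.eq_one_of_dvd_coprimes hcopac hpa hpc)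
        · exact hp.one_lt.ne' (Nat.eq_one_of_dvd_coprimes hcop hpa hpb)
      · -- `p ∣ b`: then `p ∣ a·a`
        have h1 : p ∣ a * a := by
          have : p ∣ c * b := dvd_mul_of_dvd_right hpb c
          exact (Nat.dvd_add_right this).mp hK
        have hpa := hp.dvd_of_dvd_pow (by simpa [sq] using h1 : p ∣ a ^ 2)
        exact hp.one_lt.ne' (Nat.eq_one_of_dvd_coprimes hcop hpa hpb)
    · -- `p ∣ c`: then `p ∣ a·a`
      have h1 : p ∣ a * a := by
        have : p ∣ c * b := dvd_mul_of_dvd_left hpc b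
        exact (Nat.dvd_add_right this).mp hK
      have hpa := hp.dvd_of_dvd_pow (by simpa [sq] using h1 : p ∣ a ^ 2)
      exact hp.one_lt.ne' (Nat.eq_one_of_dvd_coprimes hcopac hpa hpc)
  have hN0 : ((256 * (c * b + a * a) ^ 3 : ℕ) : ℚ) ≠ 0 := by
    have : 256 * (c * b + a * a) ^ 3 ≠ 0 := fun h0 => hN (h0 ▸ dvd_zero _)
    exact_mod_cast this
  have hD0 : (((a * b * c) ^ 2 : ℕ) : ℚ) ≠ 0 := by exact_mod_cast pow_ne_zero 2 habc0
  have hordN : ord ℚ v ((256 * (c * b + a * a) ^ 3 : ℕ) : ℚ) = 0 := by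
    unfold ord
    rw [(UniformABCConjecture.valuation_natCast_eq_one_iff v _).2 hN, WithZero.log_one, neg_zero]
  -- `ord_v(abc) = v_p(abc)`: `abc = p^k · m`, `p ∤ m`, `ord_v(p) = 1`
  have hordabc : ord ℚ v ((a * b * c : ℕ) : ℚ) = (((a * b * c).factorization p : ℕ) : ℤ) := by
    set n := a * b * c with hn
    set k := n.factorization p with hk
    set m := ordCompl[p] n with hm
    have hdec : (n : ℚ) = ((p : ℚ) ^ k) * (m : ℚ) := by
      have := Nat.ordProj_mul_ordCompl_eq_self n p
      rw [← hm] at this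
      exact_mod_cast this.symm
    have hp0 : (p : ℚ) ≠ 0 := by exact_mod_cast hp.ne_zero
    have hm0 : (m : ℚ) ≠ 0 := by exact_mod_cast (Nat.ordCompl_pos p habc0).ne'
    have hmnd : ¬ p ∣ m := Nat.not_dvd_ordCompl hp habc0
    have hordm : ord ℚ v (m : ℚ) = 0 := by
      unfold ord
      rw [(UniformABCConjecture.valuation_natCast_eq_one_iff v _).2 hmnd, WithZero.log_one, neg_zero]
    rw [hdec, ord_mul ℚ v (pow_ne_zero _ hp0) hm0, ord_pow, hordm, hpdef, ord_natGenerator_eq_one v]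
    simp
  rw [jInv_ratPoint_triple ⟨ha, hb, habc, hcop⟩, div_eq_mul_inv, ord_mul ℚ v hN0 (inv_ne_zero hD0), ord_inv, hordN]
  have hsq : (((a * b * c) ^ 2 : ℕ) : ℚ) = ((a * b * c : ℕ) : ℚ) ^ 2 := by push_cast; ring
  rw [hsq, ord_pow, hordabc]
  ring

/-- **`n ∣ v_p(abc) ⇒ (n : ℤ) ∣ ord_v j(a/c)`** at every place `v` of `ℚ` over an odd prime `p ∣ abc` of an abc triple
(the divisibility form consumed by the Tate-exact local type). [cite: Mochizuki2012, IUTchIV Cor 2.2 proof p.44] -/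
theorem natCast_dvd_ord_jInv_ratPoint_triple {a b c : ℕ} (h : IsABCTriple a b c) {p n : ℕ} (hp2 : p ≠ 2)
    (hpabc : p ∣ a * b * c) (hn : n ∣ (a * b * c).factorization p) (v : HeightOneSpectrum (𝓞 ℚ))
    (hv : Rat.HeightOneSpectrum.natGenerator v = p) : (n : ℤ) ∣ ord ℚ v (jInv ((a : ℚ) / c)) := by
  rw [ord_jInv_ratPoint_triple_eq h v (hv ▸ hp2) (hv ▸ hpabc), hv]
  exact (Int.natCast_dvd_natCast.2 hn).mul_left 2 |>.neg_right

namespace ThetaVolumeDatumAt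

variable {P : NFPoint} {l : ℕ} (T : ThetaVolumeDatumAt P l)

/-- **The tower bookkeeping, abstract form: `e(w | v₀) ∣ m ⇒ e(u | p) ∣ e(v₀ | p)·m·l`** for a place `u` of the
`l`-division field `K` of a genuine Θ-volume datum with residue characteristic `≠ l`, `w = u ∩ F`, `v₀ = u ∩ F_tpd`
(`e(u|p) = e(v₀|p)·e(w|v₀)·e(u|w)`, Neukirch II (6.8), and `e(u|w) ∣ l`, abc-iut-S-d1's `ramificationIdx_dvd_prime`).
[cite: Mochizuki2012, IUTchIV Thm. 1.10 proof Steps (ii)–(iii) p. 24–26] [cite: NeukirchANT1999, Ch. II Prop. (6.8)]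
[claim: Mochizuki2012, status: disputed] -/
theorem ramificationIdx_int_dvd_mul_of_tpd_F_dvd (m : ℕ)
    (u : letI := T.instFieldK; letI := T.instNumberFieldK; HeightOneSpectrum (𝓞 T.K))
    (hul : letI := T.instFieldK; letI := T.instNumberFieldK; residueChar T.K u ≠ l)
    (hFtpd : letI := T.instFieldF; letI := T.instNumberFieldF; letI := T.instAlgebraF; letI := T.instFieldK
      letI := T.instNumberFieldK; letI := T.instAlgebraK
      (finBelow T.F T.K u).asIdeal.ramificationIdx (𝓞 P.F) ∣ m) :
    (letI := T.instFieldK; letI := T.instNumberFieldK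
     u.asIdeal.ramificationIdx ℤ) ∣
      (letI := T.instFieldF; letI := T.instNumberFieldF; letI := T.instAlgebraF; letI := T.instFieldK
       letI := T.instNumberFieldK; letI := T.instAlgebraK
       (finBelow P.F T.F (finBelow T.F T.K u)).asIdeal.ramificationIdx ℤ) * m * l := by
  letI := T.instFieldF; letI := T.instNumberFieldF; letI := T.instAlgebraF; letI := T.instFieldK
  letI := T.instNumberFieldK; letI := T.instAlgebraK; letI := T.instFieldFbar; letI := T.instAlgebraFbar
  letI := T.instAlgebraKFbar; letI := T.instIsElliptic
  set w := finBelow T.F T.K u with hwdef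
  set v₀ := finBelow P.F T.F w with hv₀def
  have hKF : u.asIdeal.ramificationIdx (𝓞 T.F) ∣ l := T.ramificationIdx_dvd_prime u hul
  have hw_under : u.under (𝓞 T.F) = w := rfl
  have hv_under : w.under (𝓞 P.F) = v₀ := rfl
  haveI : w.asIdeal.IsMaximal := w.isMaximal
  haveI : v₀.asIdeal.IsMaximal := v₀.isMaximal
  have heuw : Ideal.ramificationIdx' w.asIdeal u.asIdeal = u.asIdeal.ramificationIdx (𝓞 T.F) :=
    Ideal.ramificationIdx'_eq_ramificationIdx w.asIdeal u.asIdeal w.ne_bot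
  have hewv : Ideal.ramificationIdx' v₀.asIdeal w.asIdeal = w.asIdeal.ramificationIdx (𝓞 P.F) :=
    Ideal.ramificationIdx'_eq_ramificationIdx v₀.asIdeal w.asIdeal v₀.ne_bot
  have heu : u.asIdeal.ramificationIdx ℤ =
      v₀.asIdeal.ramificationIdx ℤ * w.asIdeal.ramificationIdx (𝓞 P.F) * u.asIdeal.ramificationIdx (𝓞 T.F) := by
    rw [ThetaData.absRamificationIdx_eq_ramIdx_mul (F := T.F) u, hw_under,
      ramIdx_eq, ThetaData.absRamificationIdx_eq_ramIdx_mul (F := P.F) w, hv_under, ramIdx_eq, heuw, hewv]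
  rw [heu]
  exact mul_dvd_mul (mul_dvd_mul dvd_rfl hFtpd) hKF

/-- **`3 ∣ ord_{v₀} j(λ) ⇒ e(u | p) ∣ e(v₀ | p)·10·l`** for every place `u` of the `l`-division field `K` of a genuine
Θ-volume datum, of residue characteristic `p ∉ {2, 3, 5, l}`, over a BAD place `v₀ = u ∩ F_tpd` of `λ`.
[cite: Mochizuki2012, IUTchIV Thm. 1.10 proof Steps (ii)–(iii) p. 24–26] [cite: Serre1972, §1.11–§1.12]
[claim: Mochizuki2012, status: disputed] -/
theorem ramificationIdx_int_dvd_ten_mul_of_three_dvd_ord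
    (u : letI := T.instFieldK; letI := T.instNumberFieldK; HeightOneSpectrum (𝓞 T.K))
    (hu : letI := T.instFieldK; letI := T.instNumberFieldK; residueChar T.K u ∉ ({2, 3, 5, l} : Finset ℕ))
    (hbad : letI := T.instFieldF; letI := T.instNumberFieldF; letI := T.instAlgebraF; letI := T.instFieldK
      letI := T.instNumberFieldK; letI := T.instAlgebraK
      finBelow P.F T.F (finBelow T.F T.K u) ∈ badPlaces P)
    (hord : letI := T.instFieldF; letI := T.instNumberFieldF; letI := T.instAlgebraF; letI := T.instFieldK
      letI := T.instNumberFieldK; letI := T.instAlgebraK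
      (3 : ℤ) ∣ ord P.F (finBelow P.F T.F (finBelow T.F T.K u)) (jInv P.x)) :
    (letI := T.instFieldK; letI := T.instNumberFieldK
     u.asIdeal.ramificationIdx ℤ) ∣
      (letI := T.instFieldF; letI := T.instNumberFieldF; letI := T.instAlgebraF; letI := T.instFieldK
       letI := T.instNumberFieldK; letI := T.instAlgebraK
       (finBelow P.F T.F (finBelow T.F T.K u)).asIdeal.ramificationIdx ℤ) * 10 * l := by
  letI := T.instFieldF; letI := T.instNumberFieldF; letI := T.instAlgebraF; letI := T.instFieldK
  letI := T.instNumberFieldK; letI := T.instAlgebraK; letI := T.instFieldFbar; letI := T.instAlgebraFbar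
  letI := T.instAlgebraKFbar; letI := T.instIsElliptic
  haveI : IsGalois P.F T.F := (T.towerFacts T.inU).1
  simp only [Finset.mem_insert, Finset.mem_singleton, not_or] at hu
  obtain ⟨h2, h3, h5, hul⟩ := hu
  have hw : residueChar T.F (finBelow T.F T.K u) ∉ ({2, 3, 5} : Finset ℕ) := by
    rw [residueChar_finBelow]
    simp only [Finset.mem_insert, Finset.mem_singleton, not_or]
    exact ⟨h2, h3, h5⟩
  exact T.ramificationIdx_int_dvd_mul_of_tpd_F_dvd 10 u hul
    (ramificationIdx_subThetaField_dvd_ten_of_three_dvd_ord T.F T.inU T.isSubThetaField (finBelow T.F T.K u) hbad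
      (thirty_notMem_finBelow_of_residueChar_notMem _ hw) hord)

/-- **`5 ∣ ord_{v₀} j(λ) ⇒ e(u | p) ∣ e(v₀ | p)·6·l`** (same setting). [cite: Mochizuki2012, IUTchIV Thm. 1.10 proof Steps (ii)–(iii) p. 24–26]
[cite: Serre1972, §1.11–§1.12] [claim: Mochizuki2012, status: disputed] -/
theorem ramificationIdx_int_dvd_six_mul_of_five_dvd_ord
    (u : letI := T.instFieldK; letI := T.instNumberFieldK; HeightOneSpectrum (𝓞 T.K))
    (hu : letI := T.instFieldK; letI := T.instNumberFieldK; residueChar T.K u ∉ ({2, 3, 5, l} : Finset ℕ))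
    (hbad : letI := T.instFieldF; letI := T.instNumberFieldF; letI := T.instAlgebraF; letI := T.instFieldK
      letI := T.instNumberFieldK; letI := T.instAlgebraK
      finBelow P.F T.F (finBelow T.F T.K u) ∈ badPlaces P)
    (hord : letI := T.instFieldF; letI := T.instNumberFieldF; letI := T.instAlgebraF; letI := T.instFieldK
      letI := T.instNumberFieldK; letI := T.instAlgebraK
      (5 : ℤ) ∣ ord P.F (finBelow P.F T.F (finBelow T.F T.K u)) (jInv P.x)) :
    (letI := T.instFieldK; letI := T.instNumberFieldK
     u.asIdeal.ramificationIdx ℤ) ∣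
      (letI := T.instFieldF; letI := T.instNumberFieldF; letI := T.instAlgebraF; letI := T.instFieldK
       letI := T.instNumberFieldK; letI := T.instAlgebraK
       (finBelow P.F T.F (finBelow T.F T.K u)).asIdeal.ramificationIdx ℤ) * 6 * l := by
  letI := T.instFieldF; letI := T.instNumberFieldF; letI := T.instAlgebraF; letI := T.instFieldK
  letI := T.instNumberFieldK; letI := T.instAlgebraK; letI := T.instFieldFbar; letI := T.instAlgebraFbar
  letI := T.instAlgebraKFbar; letI := T.instIsElliptic
  haveI : IsGalois P.F T.F := (T.towerFacts T.inU).1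
  simp only [Finset.mem_insert, Finset.mem_singleton, not_or] at hu
  obtain ⟨h2, h3, h5, hul⟩ := hu
  have hw : residueChar T.F (finBelow T.F T.K u) ∉ ({2, 3, 5} : Finset ℕ) := by
    rw [residueChar_finBelow]
    simp only [Finset.mem_insert, Finset.mem_singleton, not_or]
    exact ⟨h2, h3, h5⟩
  exact T.ramificationIdx_int_dvd_mul_of_tpd_F_dvd 6 u hul
    (ramificationIdx_subThetaField_dvd_six_of_five_dvd_ord T.F T.inU T.isSubThetaField (finBelow T.F T.K u) hbad
      (thirty_notMem_finBelow_of_residueChar_notMem _ hw) hord)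

/-- **`15 ∣ ord_{v₀} j(λ) ⇒ e(u | p) ∣ e(v₀ | p)·2·l`** (same setting). [cite: Mochizuki2012, IUTchIV Thm. 1.10 proof Steps (ii)–(iii) p. 24–26]
[cite: Serre1972, §1.11–§1.12] [claim: Mochizuki2012, status: disputed] -/
theorem ramificationIdx_int_dvd_two_mul_of_fifteen_dvd_ord
    (u : letI := T.instFieldK; letI := T.instNumberFieldK; HeightOneSpectrum (𝓞 T.K))
    (hu : letI := T.instFieldK; letI := T.instNumberFieldK; residueChar T.K u ∉ ({2, 3, 5, l} : Finset ℕ))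
    (hbad : letI := T.instFieldF; letI := T.instNumberFieldF; letI := T.instAlgebraF; letI := T.instFieldK
      letI := T.instNumberFieldK; letI := T.instAlgebraK
      finBelow P.F T.F (finBelow T.F T.K u) ∈ badPlaces P)
    (hord : letI := T.instFieldF; letI := T.instNumberFieldF; letI := T.instAlgebraF; letI := T.instFieldK
      letI := T.instNumberFieldK; letI := T.instAlgebraK
      (15 : ℤ) ∣ ord P.F (finBelow P.F T.F (finBelow T.F T.K u)) (jInv P.x)) :
    (letI := T.instFieldK; letI := T.instNumberFieldK
     u.asIdeal.ramificationIdx ℤ) ∣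
      (letI := T.instFieldF; letI := T.instNumberFieldF; letI := T.instAlgebraF; letI := T.instFieldK
       letI := T.instNumberFieldK; letI := T.instAlgebraK
       (finBelow P.F T.F (finBelow T.F T.K u)).asIdeal.ramificationIdx ℤ) * 2 * l := by
  letI := T.instFieldF; letI := T.instNumberFieldF; letI := T.instAlgebraF; letI := T.instFieldK
  letI := T.instNumberFieldK; letI := T.instAlgebraK; letI := T.instFieldFbar; letI := T.instAlgebraFbar
  letI := T.instAlgebraKFbar; letI := T.instIsElliptic
  haveI : IsGalois P.F T.F := (T.towerFacts T.inU).1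
  simp only [Finset.mem_insert, Finset.mem_singleton, not_or] at hu
  obtain ⟨h2, h3, h5, hul⟩ := hu
  have hw : residueChar T.F (finBelow T.F T.K u) ∉ ({2, 3, 5} : Finset ℕ) := by
    rw [residueChar_finBelow]
    simp only [Finset.mem_insert, Finset.mem_singleton, not_or]
    exact ⟨h2, h3, h5⟩
  exact T.ramificationIdx_int_dvd_mul_of_tpd_F_dvd 2 u hul
    (ramificationIdx_subThetaField_dvd_two_of_fifteen_dvd_ord T.F T.inU T.isSubThetaField (finBelow T.F T.K u) hbad
      (thirty_notMem_finBelow_of_residueChar_notMem _ hw) hord)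

/-- The place of `ℚ` under a place `u` of `T.K` of residue characteristic `p` (rational point) has `natGenerator = p`.
[folklore] -/
private theorem natGenerator_finBelow_ratPoint {q : ℚ} {l : ℕ} (T : ThetaVolumeDatumAt (ratPoint q) l) {p : ℕ}
    (u : letI := T.instFieldK; letI := T.instNumberFieldK; HeightOneSpectrum (𝓞 T.K))
    (hu : letI := T.instFieldK; letI := T.instNumberFieldK; residueChar T.K u = p) :
    letI := T.instFieldF; letI := T.instNumberFieldF; letI := T.instAlgebraF; letI := T.instFieldK
    letI := T.instNumberFieldK; letI := T.instAlgebraK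
    Rat.HeightOneSpectrum.natGenerator
      (show HeightOneSpectrum (𝓞 ℚ) from finBelow (ratPoint q).F T.F (finBelow T.F T.K u)) = p := by
  letI := T.instFieldF; letI := T.instNumberFieldF; letI := T.instAlgebraF; letI := T.instFieldK
  letI := T.instNumberFieldK; letI := T.instAlgebraK
  set v : HeightOneSpectrum (𝓞 ℚ) := finBelow (ratPoint q).F T.F (finBelow T.F T.K u) with hvdef
  have hchar : residueChar ℚ v = p := by
    rw [hvdef]
    change residueChar (ratPoint q).F (finBelow (ratPoint q).F T.F (finBelow T.F T.K u)) = p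
    rw [residueChar_finBelow, residueChar_finBelow, hu]
  have hpp : p.Prime := hchar ▸ residueChar_prime ℚ v
  have hmem : ((p : ℕ) : 𝓞 ℚ) ∈ v.asIdeal := by
    rw [natCast_mem_asIdeal_iff_residueChar_eq v hpp]; exact hchar
  have hdvd := (Literature.NumberTheory.DiophantineGeometry.UniformABCConjecture.natCast_mem_asIdeal_iff v p).1 hmem
  exact (Nat.prime_dvd_prime_iff_eq (Rat.HeightOneSpectrum.prime_natGenerator v) hpp).1 hdvd

/-- **At a RATIONAL point: `3 ∣ ord_p j(q) ⇒ e(u | p) ∣ 10·l`** for every place `u` of `T.K` of residue characteristic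
`p ∉ {2, 3, 5, l}` over a pole of `j(q)` (`ord_p j(q) < 0` and `3 ∣ ord_p j(q)` at every place of `ℚ` over `p`).
[cite: Mochizuki2012, IUTchIV Thm. 1.10 proof Steps (ii)–(iii) p. 24–26] [cite: Serre1972, §1.11–§1.12] [claim: Mochizuki2012, status: disputed] -/
theorem ramificationIdx_int_dvd_ten_mul_ratPoint' {q : ℚ} {l : ℕ} (T : ThetaVolumeDatumAt (ratPoint q) l)
    {p : ℕ} (hp : p ∉ ({2, 3, 5, l} : Finset ℕ))
    (hpole : ∀ v : HeightOneSpectrum (𝓞 ℚ), Rat.HeightOneSpectrum.natGenerator v = p → ord ℚ v (jInv q) < 0)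
    (hord : ∀ v : HeightOneSpectrum (𝓞 ℚ), Rat.HeightOneSpectrum.natGenerator v = p → (3 : ℤ) ∣ ord ℚ v (jInv q))
    (u : letI := T.instFieldK; letI := T.instNumberFieldK; HeightOneSpectrum (𝓞 T.K))
    (hu : letI := T.instFieldK; letI := T.instNumberFieldK; residueChar T.K u = p) :
    (letI := T.instFieldK; letI := T.instNumberFieldK
     u.asIdeal.ramificationIdx ℤ) ∣ 10 * l := by
  letI := T.instFieldF; letI := T.instNumberFieldF; letI := T.instAlgebraF; letI := T.instFieldK
  letI := T.instNumberFieldK; letI := T.instAlgebraK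
  have hvp := T.natGenerator_finBelow_ratPoint u hu
  have h := T.ramificationIdx_int_dvd_ten_mul_of_three_dvd_ord u (by rw [hu]; exact hp)
    ((mem_badPlaces_iff_ord_neg (ratPoint q) _).2 (hpole _ hvp)) (hord _ hvp)
  have h1 : (finBelow (ratPoint q).F T.F (finBelow T.F T.K u)).asIdeal.ramificationIdx ℤ = 1 :=
    Literature.NumberTheory.EllipticCurves.Fisher2016.ramificationIdx_int_rat_eq_one _
  rw [h1, one_mul] at h
  exact h

/-- **At a RATIONAL point: `5 ∣ ord_p j(q) ⇒ e(u | p) ∣ 6·l`** (same setting).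
[cite: Mochizuki2012, IUTchIV Thm. 1.10 proof Steps (ii)–(iii) p. 24–26] [cite: Serre1972, §1.11–§1.12] [claim: Mochizuki2012, status: disputed] -/
theorem ramificationIdx_int_dvd_six_mul_ratPoint' {q : ℚ} {l : ℕ} (T : ThetaVolumeDatumAt (ratPoint q) l)
    {p : ℕ} (hp : p ∉ ({2, 3, 5, l} : Finset ℕ))
    (hpole : ∀ v : HeightOneSpectrum (𝓞 ℚ), Rat.HeightOneSpectrum.natGenerator v = p → ord ℚ v (jInv q) < 0)
    (hord : ∀ v : HeightOneSpectrum (𝓞 ℚ), Rat.HeightOneSpectrum.natGenerator v = p → (5 : ℤ) ∣ ord ℚ v (jInv q))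
    (u : letI := T.instFieldK; letI := T.instNumberFieldK; HeightOneSpectrum (𝓞 T.K))
    (hu : letI := T.instFieldK; letI := T.instNumberFieldK; residueChar T.K u = p) :
    (letI := T.instFieldK; letI := T.instNumberFieldK
     u.asIdeal.ramificationIdx ℤ) ∣ 6 * l := by
  letI := T.instFieldF; letI := T.instNumberFieldF; letI := T.instAlgebraF; letI := T.instFieldK
  letI := T.instNumberFieldK; letI := T.instAlgebraK
  have hvp := T.natGenerator_finBelow_ratPoint u hu
  have h := T.ramificationIdx_int_dvd_six_mul_of_five_dvd_ord u (by rw [hu]; exact hp)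
    ((mem_badPlaces_iff_ord_neg (ratPoint q) _).2 (hpole _ hvp)) (hord _ hvp)
  have h1 : (finBelow (ratPoint q).F T.F (finBelow T.F T.K u)).asIdeal.ramificationIdx ℤ = 1 :=
    Literature.NumberTheory.EllipticCurves.Fisher2016.ramificationIdx_int_rat_eq_one _
  rw [h1, one_mul] at h
  exact h

/-- **At a RATIONAL point: `15 ∣ ord_p j(q) ⇒ e(u | p) ∣ 2·l`** (same setting).
[cite: Mochizuki2012, IUTchIV Thm. 1.10 proof Steps (ii)–(iii) p. 24–26] [cite: Serre1972, §1.11–§1.12] [claim: Mochizuki2012, status: disputed] -/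
theorem ramificationIdx_int_dvd_two_mul_ratPoint' {q : ℚ} {l : ℕ} (T : ThetaVolumeDatumAt (ratPoint q) l)
    {p : ℕ} (hp : p ∉ ({2, 3, 5, l} : Finset ℕ))
    (hpole : ∀ v : HeightOneSpectrum (𝓞 ℚ), Rat.HeightOneSpectrum.natGenerator v = p → ord ℚ v (jInv q) < 0)
    (hord : ∀ v : HeightOneSpectrum (𝓞 ℚ), Rat.HeightOneSpectrum.natGenerator v = p → (15 : ℤ) ∣ ord ℚ v (jInv q))
    (u : letI := T.instFieldK; letI := T.instNumberFieldK; HeightOneSpectrum (𝓞 T.K))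
    (hu : letI := T.instFieldK; letI := T.instNumberFieldK; residueChar T.K u = p) :
    (letI := T.instFieldK; letI := T.instNumberFieldK
     u.asIdeal.ramificationIdx ℤ) ∣ 2 * l := by
  letI := T.instFieldF; letI := T.instNumberFieldF; letI := T.instAlgebraF; letI := T.instFieldK
  letI := T.instNumberFieldK; letI := T.instAlgebraK
  have hvp := T.natGenerator_finBelow_ratPoint u hu
  have h := T.ramificationIdx_int_dvd_two_mul_of_fifteen_dvd_ord u (by rw [hu]; exact hp)
    ((mem_badPlaces_iff_ord_neg (ratPoint q) _).2 (hpole _ hvp)) (hord _ hvp)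
  have h1 : (finBelow (ratPoint q).F T.F (finBelow T.F T.K u)).asIdeal.ramificationIdx ℤ = 1 :=
    Literature.NumberTheory.EllipticCurves.Fisher2016.ramificationIdx_int_rat_eq_one _
  rw [h1, one_mul] at h
  exact h

end ThetaVolumeDatumAt

end Cor22

end Literature.IUT.LogVolume

end
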